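import Literature.Geometry.Riemannian.HarmonicReplacementBall
import Literature.Geometry.Riemannian.DirichletMinimiserEnergy
import Literature.Geometry.Riemannian.HopfRinowHeineBorel
import HarnessLib

/-!
# The harmonic replacement on a ball does not increase the Dirichlet energy

Continuation of `HarmonicReplacementBall.lean` (Cheeger–Colding 1996, §6: the harmonic
replacement `𝔟` of a function `b` on a ball is used through `∫_B |∇𝔟|² ≤ ∫_B |∇b|²` and the
resulting `L²`-smallness of `∇(b − 𝔟)`). For the variational replacement `v` of `χ` on the open
ball `B = B_r(p)` (`χ − v ∈ H¹₀(B)`, `v` smooth harmonic on `B`, `vₙ ∈ C_c^∞` vanishing off `B`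
with `vₙ → χ − v` in `L²(B)` and energies `E(vₙ) = ∫ |d(χ − vₙ)|² → m_E = inf E`):

* `integral_mul_innerDual_mvfderiv_eq_neg_of_tsupport`, `integral_mul_gradSq_le_of_tendsto_of_tsupport`
  — local forms of the energy lemmas of `DirichletMinimiserEnergy.lean` (harmonicity and the
  convergence hypothesis only on `tsupport φ`), same proofs;
* `lintegral_ball_ofReal_le_of_forall_cutoff` — from `∫ φ G ≤ m` for all cutoffs
  `φ ∈ C_c^∞(B; [0,1])` to `∫_B G ≤ m` (exhaustion of the ball by the compact closed balls
  `{d(p,·) ≤ r − 1/(k+1)}`, Hopf–Rinow, smooth Urysohn, monotone convergence);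
* `lintegral_ball_gradSq_replacement_le` — **`∫_B |dv|² ≤ m_E ≤ ∫ |dχ|²`** for the harmonic
  replacement of `exists_harmonic_replacement_ball`: the replacement has finite Dirichlet energy on
  the ball, at most the energy of `χ` (Dirichlet's principle).

No definitions, no named facts (D-0026). Groundwork for `CheegerColding1997_sphereStability`.

## References

* J. Cheeger, T. H. Colding, Ann. of Math. 144 (1996) 189–237, §6. [CheegerColding1996]
* G. Carron, arXiv:0704.3194 (2007), Prop. 2.5 (the cutoff energy argument). [Carron2007]
* D. Gilbarg, N. Trudinger, *Elliptic PDE of second order*, §8.2. [GilbargTrudinger2001]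
-/

noncomputable section

open Bundle Set Function Filter Topology MeasureTheory
open scoped Manifold ContDiff ENNReal NNReal

namespace Literature.Geometry.Riemannian

open Literature.Geometry.Lorentzian
open Literature.Geometry.Lorentzian.PseudoRiemannianMetric

/-! ### §1 Local forms of the cutoff energy lemmas -/

section Energy

variable {m : ℕ} {H : Type*} [TopologicalSpace H]
  {I : ModelWithCorners ℝ (EuclideanSpace ℝ (Fin m)) H} [I.Boundaryless]
  {N : Type*} [TopologicalSpace N] [ChartedSpace H N] [IsManifold I ∞ N]
  [T3Space N] [SecondCountableTopology N] [MeasurableSpace N] [BorelSpace N]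
  (h : ContMDiffRiemannianMetric I ∞ (EuclideanSpace ℝ (Fin m)) (TangentSpace I : N → Type _))
  [(ofRiemannian h).HasLeviCivita]

/-- **Green's identity tested on `φ dũ`, local form**: for `ũ ∈ C^∞(N)` harmonic ON `tsupport φ`
(`Δ_h ũ = 0` there), `w ∈ C^∞(N)`
and `φ ∈ C_c^∞(N)`, `∫ φ h⁻¹(dw, dũ) dV_h = -∫ w h⁻¹(dφ, dũ) dV_h`. Proof: Green's first identity
`∫ (φ w) Δ_h ũ = -∫ h⁻¹(d(φ w), dũ)` (`integral_mul_dalembertian_eq_neg_integral_innerDual_of_hasCompactSupport`)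
with `Δ_h ũ = 0` and `d(φ w) = φ dw + w dφ`. This replaces a divergence theorem for the compactly
supported `1`-form `φ w dũ`. [cite: Carron2007, Prop. 2.5] -/
theorem integral_mul_innerDual_mvfderiv_eq_neg_of_tsupport {ũ w φ : N → ℝ}
    (hũ : ContMDiff I 𝓘(ℝ, ℝ) ∞ ũ) (hw : ContMDiff I 𝓘(ℝ, ℝ) ∞ w)
    (hφ : ContMDiff I 𝓘(ℝ, ℝ) ∞ φ) (hφc : HasCompactSupport φ)
    (hΔ : ∀ x ∈ tsupport φ, (ofRiemannian h).dalembertian ũ x = 0) :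
    ∫ x, φ x * (ofRiemannian h).innerDual x (mvfderiv I w x).toLinearMap (mvfderiv I ũ x).toLinearMap
        ∂riemannianMeasure h =
      -∫ x, w x * (ofRiemannian h).innerDual x (mvfderiv I φ x).toLinearMap
        (mvfderiv I ũ x).toLinearMap ∂riemannianMeasure h := by
  haveI : LocallyCompactSpace N := Manifold.locallyCompact_of_finiteDimensional I
  haveI : IsFiniteMeasureOnCompacts (riemannianMeasure h) :=
    ⟨fun K hK ↦ riemannianVolume_lt_top_of_isCompact_holds h le_rfl hK⟩
  -- Green's identity for `u = φ w`
  have hu1 : CMDiff 1 (fun x ↦ φ x * w x) := by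
    exact_mod_cast contMDiff_infty.1 (hφ.mul hw) 1
  have huc : HasCompactSupport (fun x ↦ φ x * w x) := hφc.mul_right
  have hũ2 : CMDiff 2 ũ := by exact_mod_cast contMDiff_infty.1 hũ 2
  have hG := integral_mul_dalembertian_eq_neg_integral_innerDual_of_hasCompactSupport h hu1 huc hũ2
  have hL : ∫ x, φ x * w x * (ofRiemannian h).dalembertian ũ x ∂riemannianMeasure h = 0 := by
    refine (integral_congr_ae (Eventually.of_forall fun x ↦ ?_)).trans (integral_zero N ℝ)
    show φ x * w x * (ofRiemannian h).dalembertian ũ x = (0 : N → ℝ) x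
    by_cases hx : x ∈ tsupport φ
    · rw [hΔ x hx, mul_zero, Pi.zero_apply]
    · rw [image_eq_zero_of_notMem_tsupport hx, zero_mul, zero_mul, Pi.zero_apply]
  rw [hL] at hG
  -- the product rule `d(φ w) = φ dw + w dφ`, and bilinearity of `h⁻¹`
  have hφ1 : CMDiff 1 φ := by exact_mod_cast contMDiff_infty.1 hφ 1
  have hw1 : CMDiff 1 w := by exact_mod_cast contMDiff_infty.1 hw 1
  have hũ1 : CMDiff 1 ũ := by exact_mod_cast contMDiff_infty.1 hũ 1
  have hpt : ∀ x, (ofRiemannian h).innerDual x (mvfderiv I (fun x ↦ φ x * w x) x).toLinearMap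
      (mvfderiv I ũ x).toLinearMap =
      φ x * (ofRiemannian h).innerDual x (mvfderiv I w x).toLinearMap (mvfderiv I ũ x).toLinearMap +
      w x * (ofRiemannian h).innerDual x (mvfderiv I φ x).toLinearMap (mvfderiv I ũ x).toLinearMap := by
    intro x
    have hdφ : MDiffAt φ x := (hφ1 x).mdifferentiableAt one_ne_zero
    have hdw : MDiffAt w x := (hw1 x).mdifferentiableAt one_ne_zero
    rw [mvfderiv_fun_mul hdφ hdw]
    simp only [PseudoRiemannianMetric.innerDual, ContinuousLinearMap.toLinearMap_add,
      ContinuousLinearMap.toLinearMap_smul, LinearMap.add_apply, LinearMap.smul_apply, smul_eq_mul]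
  -- integrability of both terms (continuous with compact support in `tsupport φ`)
  have hc1 : Continuous fun x ↦ (ofRiemannian h).innerDual x (mvfderiv I w x).toLinearMap
      (mvfderiv I ũ x).toLinearMap := continuous_innerDual_mvfderiv _ hw1 hũ1
  have hc2 : Continuous fun x ↦ (ofRiemannian h).innerDual x (mvfderiv I φ x).toLinearMap
      (mvfderiv I ũ x).toLinearMap := continuous_innerDual_mvfderiv _ hφ1 hũ1
  have hI1 : Integrable (fun x ↦ φ x * (ofRiemannian h).innerDual x (mvfderiv I w x).toLinearMap
      (mvfderiv I ũ x).toLinearMap) (riemannianMeasure h) :=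
    (hφ.continuous.mul hc1).integrable_of_hasCompactSupport hφc.mul_right
  have hs2 : HasCompactSupport fun x ↦ w x * (ofRiemannian h).innerDual x (mvfderiv I φ x).toLinearMap
      (mvfderiv I ũ x).toLinearMap := by
    refine HasCompactSupport.of_support_subset_isCompact hφc.isCompact fun x hx ↦ ?_
    by_contra hx'
    apply hx
    simp [PseudoRiemannianMetric.innerDual, mvfderiv_eq_zero_of_notMem_tsupport hx']
  have hI2 : Integrable (fun x ↦ w x * (ofRiemannian h).innerDual x (mvfderiv I φ x).toLinearMap
      (mvfderiv I ũ x).toLinearMap) (riemannianMeasure h) :=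
    (hw.continuous.mul hc2).integrable_of_hasCompactSupport hs2
  have hsplit : ∫ x, (ofRiemannian h).innerDual x (mvfderiv I (fun x ↦ φ x * w x) x).toLinearMap
      (mvfderiv I ũ x).toLinearMap ∂riemannianMeasure h =
      (∫ x, φ x * (ofRiemannian h).innerDual x (mvfderiv I w x).toLinearMap (mvfderiv I ũ x).toLinearMap
        ∂riemannianMeasure h) +
      ∫ x, w x * (ofRiemannian h).innerDual x (mvfderiv I φ x).toLinearMap (mvfderiv I ũ x).toLinearMap
        ∂riemannianMeasure h := by
    rw [← integral_add hI1 hI2]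
    exact integral_congr_ae (Eventually.of_forall hpt)
  rw [hsplit] at hG
  linarith


/-- **The energy bound on a cutoff, local form** (`Δ_h ũ = 0` only on `tsupport φ`, the
convergence hypothesis only for test fields supported in `tsupport φ`; otherwise Carron 2007,
Prop. 2.5: `dh = η ∈ L²`, `η = L²-lim d(u - v_k)`).
Let `χ, ũ ∈ C^∞(N)` with `Δ_h ũ = 0`, `vₙ ∈ C_c^∞(N)` with energies
`E(vₙ) = ∫ |d(χ - vₙ)|²_h → m`, and suppose `∫ ((χ - vₙ) - ũ) F dV_h → 0` for every continuous
compactly supported `F` (the `L^q` convergence of `χ - vₙ` to `ũ`). Then for every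
`φ ∈ C_c^∞(N)` with `0 ≤ φ ≤ 1`: `∫ φ |dũ|²_h dV_h ≤ m`. Proof:
`∫ φ |dũ|² = -∫ ũ h⁻¹(dφ, dũ) = lim (-∫ (χ - vₙ) h⁻¹(dφ, dũ)) = lim ∫ φ h⁻¹(d(χ - vₙ), dũ)`
(`integral_mul_innerDual_mvfderiv_eq_neg` twice) and, by Cauchy–Schwarz pointwise and in `L²`,
`|∫ φ h⁻¹(d(χ - vₙ), dũ)| ≤ √E(vₙ) √(∫ φ |dũ|²)`. [cite: Carron2007, Prop. 2.5] -/
theorem integral_mul_gradSq_le_of_tendsto_of_tsupport {χ ũ : N → ℝ} (hχ : ContMDiff I 𝓘(ℝ, ℝ) ∞ χ)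
    (hũ : ContMDiff I 𝓘(ℝ, ℝ) ∞ ũ)
    {v : ℕ → N → ℝ} (hv : ∀ n, ContMDiff I 𝓘(ℝ, ℝ) ∞ (v n)) (hvc : ∀ n, HasCompactSupport (v n))
    {K₁ : Set N} (hK₁ : IsCompact K₁) (hχK : ∀ x ∉ K₁, mvfderiv I χ x = 0) {m' : ℝ}
    (hE : Tendsto (fun n ↦ ∫ x, (ofRiemannian h).gradSq (χ - v n) x ∂riemannianMeasure h)
      atTop (𝓝 m'))
    {φ : N → ℝ} (hφ : ContMDiff I 𝓘(ℝ, ℝ) ∞ φ) (hφc : HasCompactSupport φ)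
    (hφ0 : ∀ x, 0 ≤ φ x) (hφ1 : ∀ x, φ x ≤ 1)
    (hΔ : ∀ x ∈ tsupport φ, (ofRiemannian h).dalembertian ũ x = 0)
    (hconv : ∀ F : N → ℝ, Continuous F → HasCompactSupport F → support F ⊆ tsupport φ →
      Tendsto (fun n ↦ ∫ x, ((χ x - v n x) - ũ x) * F x ∂riemannianMeasure h) atTop (𝓝 0)) :
    ∫ x, φ x * (ofRiemannian h).gradSq ũ x ∂riemannianMeasure h ≤ m' := by
  haveI : LocallyCompactSpace N := Manifold.locallyCompact_of_finiteDimensional I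
  haveI : IsFiniteMeasureOnCompacts (riemannianMeasure h) :=
    ⟨fun K hK ↦ riemannianVolume_lt_top_of_isCompact_holds h le_rfl hK⟩
  have hg : (ofRiemannian h).IsRiemannian := isRiemannian_ofRiemannian h
  set ν : Measure N := riemannianMeasure h with hν
  have hũ1 : CMDiff 1 ũ := by exact_mod_cast contMDiff_infty.1 hũ 1
  have hφ1' : CMDiff 1 φ := by exact_mod_cast contMDiff_infty.1 hφ 1
  -- the test field `F = h⁻¹(dφ, dũ)`, continuous with compact support
  set F : N → ℝ := fun x ↦ (ofRiemannian h).innerDual x (mvfderiv I φ x).toLinearMap (mvfderiv I ũ x).toLinearMap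
    with hF
  have hFc : Continuous F := continuous_innerDual_mvfderiv _ hφ1' hũ1
  have hFsupp : support F ⊆ tsupport φ := fun x hx ↦ by
    by_contra hx'
    apply hx
    simp [hF, PseudoRiemannianMetric.innerDual, mvfderiv_eq_zero_of_notMem_tsupport hx']
  have hFs : HasCompactSupport F :=
    HasCompactSupport.of_support_subset_isCompact hφc.isCompact hFsupp
  -- `G = |dũ|²`, and `T = ∫ φ G = -∫ ũ F`
  set G : N → ℝ := (ofRiemannian h).gradSq ũ with hGdef
  have hG0 : ∀ x, 0 ≤ G x := fun x ↦ innerDual_self_nonneg (h := h) x _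
  have hGc : Continuous G := continuous_innerDual_mvfderiv _ hũ1 hũ1
  set T : ℝ := ∫ x, φ x * G x ∂ν with hTdef
  have hT0 : 0 ≤ T := integral_nonneg fun x ↦ mul_nonneg (hφ0 x) (hG0 x)
  have hTeq : T = -∫ x, ũ x * F x ∂ν :=
    integral_mul_innerDual_mvfderiv_eq_neg_of_tsupport h hũ hũ hφ hφc hΔ
  -- `Tₙ = ∫ φ h⁻¹(d(χ - vₙ), dũ) = -∫ (χ - vₙ) F`
  set Tn : ℕ → ℝ := fun n ↦ ∫ x, φ x * (ofRiemannian h).innerDual x (mvfderiv I (χ - v n) x).toLinearMap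
    (mvfderiv I ũ x).toLinearMap ∂ν with hTn
  have hTn_eq : ∀ n, Tn n = -∫ x, (χ x - v n x) * F x ∂ν := fun n ↦
    integral_mul_innerDual_mvfderiv_eq_neg_of_tsupport h hũ (hχ.sub (hv n)) hφ hφc hΔ
  -- `Tₙ → T`
  have hlim : Tendsto Tn atTop (𝓝 T) := by
    have hIũ : Integrable (fun x ↦ ũ x * F x) ν :=
      (hũ.continuous.mul hFc).integrable_of_hasCompactSupport hFs.mul_left
    have hIn : ∀ n, Integrable (fun x ↦ (χ x - v n x) * F x) ν := fun n ↦
      ((hχ.sub (hv n)).continuous.mul hFc).integrable_of_hasCompactSupport hFs.mul_left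
    have h1 := hconv F hFc hFs hFsupp
    have h2 : ∀ n, Tn n - T = -∫ x, ((χ x - v n x) - ũ x) * F x ∂ν := by
      intro n
      have h3 : ∫ x, ((χ x - v n x) - ũ x) * F x ∂ν =
          (∫ x, (χ x - v n x) * F x ∂ν) - ∫ x, ũ x * F x ∂ν := by
        rw [← integral_sub (hIn n) hIũ]
        exact integral_congr_ae (Eventually.of_forall fun x ↦ by ring)
      rw [hTn_eq n, hTeq, h3]
      ring
    have h3 : Tendsto (fun n ↦ Tn n - T) atTop (𝓝 0) := by
      simp_rw [h2]
      simpa using h1.neg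
    have h4 := h3.add_const T
    simpa using h4
  -- `|Tₙ| ≤ √Eₙ √T`
  have hbound : ∀ n, |Tn n| ≤ Real.sqrt (∫ x, (ofRiemannian h).gradSq (χ - v n) x ∂ν) * Real.sqrt T := by
    intro n
    have hw1 : CMDiff 1 (χ - v n) := by exact_mod_cast contMDiff_infty.1 (hχ.sub (hv n)) 1
    set a : N → ℝ := fun x ↦ Real.sqrt (φ x * (ofRiemannian h).gradSq (χ - v n) x) with ha
    set b : N → ℝ := fun x ↦ Real.sqrt (φ x * G x) with hb
    have hgn0 : ∀ x, 0 ≤ (ofRiemannian h).gradSq (χ - v n) x := fun x ↦ innerDual_self_nonneg (h := h) x _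
    have hgc : Continuous ((ofRiemannian h).gradSq (χ - v n)) := continuous_innerDual_mvfderiv _ hw1 hw1
    have hac : Continuous a := (hφ.continuous.mul hgc).sqrt
    have hbc : Continuous b := (hφ.continuous.mul hGc).sqrt
    have has : HasCompactSupport a := by
      refine HasCompactSupport.of_support_subset_isCompact hφc.isCompact fun x hx ↦ ?_
      by_contra hx'
      apply hx
      simp [ha, image_eq_zero_of_notMem_tsupport hx']
    have hbs : HasCompactSupport b := by
      refine HasCompactSupport.of_support_subset_isCompact hφc.isCompact fun x hx ↦ ?_
      by_contra hx'
      apply hx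
      simp [hb, image_eq_zero_of_notMem_tsupport hx']
    -- pointwise: `|φ h⁻¹(dwₙ, dũ)| ≤ a b`
    have hpt : ∀ x, |φ x * (ofRiemannian h).innerDual x (mvfderiv I (χ - v n) x).toLinearMap
        (mvfderiv I ũ x).toLinearMap| ≤ a x * b x := by
      intro x
      rw [abs_mul, abs_of_nonneg (hφ0 x), ha, hb]
      dsimp only
      rw [Real.sqrt_mul (hφ0 x), Real.sqrt_mul (hφ0 x)]
      -- Cauchy–Schwarz for `h⁻¹` (an inner product through `♯`)
      have hcs : |(ofRiemannian h).innerDual x (mvfderiv I (χ - v n) x).toLinearMap (mvfderiv I ũ x).toLinearMap| ≤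
          Real.sqrt ((ofRiemannian h).gradSq (χ - v n) x) * Real.sqrt (G x) := by
        letI := (ofRiemannian h).riemannianBundle hg
        simp only [hGdef, PseudoRiemannianMetric.gradSq]
        rw [PseudoRiemannianMetric.innerDual_eq_val_sharp_sharp,
          PseudoRiemannianMetric.innerDual_eq_val_sharp_sharp,
          PseudoRiemannianMetric.innerDual_eq_val_sharp_sharp, ← (ofRiemannian h).inner_eq hg, ← (ofRiemannian h).inner_eq hg,
          ← (ofRiemannian h).inner_eq hg, real_inner_self_eq_norm_sq, real_inner_self_eq_norm_sq,
          Real.sqrt_sq (norm_nonneg _), Real.sqrt_sq (norm_nonneg _)]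
        exact abs_real_inner_le_norm _ _
      calc φ x * |(ofRiemannian h).innerDual x (mvfderiv I (χ - v n) x).toLinearMap (mvfderiv I ũ x).toLinearMap|
          ≤ φ x * (Real.sqrt ((ofRiemannian h).gradSq (χ - v n) x) * Real.sqrt (G x)) :=
            mul_le_mul_of_nonneg_left hcs (hφ0 x)
        _ = Real.sqrt (φ x) * Real.sqrt ((ofRiemannian h).gradSq (χ - v n) x) * (Real.sqrt (φ x) * Real.sqrt (G x)) := by
            have key : ∀ s a b : ℝ, 0 ≤ s → s * (a * b) = Real.sqrt s * a * (Real.sqrt s * b) := by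
              intro s a b hs
              rw [show Real.sqrt s * a * (Real.sqrt s * b) = (Real.sqrt s * Real.sqrt s) * (a * b) by
                ring, Real.mul_self_sqrt hs]
            exact key _ _ _ (hφ0 x)
    -- Cauchy–Schwarz in `L²`
    have hma : MemLp a (ENNReal.ofReal 2) ν := hac.memLp_of_hasCompactSupport has
    have hmb : MemLp b (ENNReal.ofReal 2) ν := hbc.memLp_of_hasCompactSupport hbs
    have hCS := integral_mul_le_Lp_mul_Lq_of_nonneg Real.HolderConjugate.two_two
      (Eventually.of_forall fun x ↦ Real.sqrt_nonneg _) (Eventually.of_forall fun x ↦ Real.sqrt_nonneg _)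
      hma hmb
    have ha2 : ∫ x, a x ^ (2 : ℝ) ∂ν ≤ ∫ x, (ofRiemannian h).gradSq (χ - v n) x ∂ν := by
      obtain ⟨-, -, hIw⟩ : Continuous ((ofRiemannian h).gradSq (χ - v n)) ∧ HasCompactSupport ((ofRiemannian h).gradSq (χ - v n)) ∧
          Integrable ((ofRiemannian h).gradSq (χ - v n)) ν := by
        refine ⟨hgc, ?_, ?_⟩
        · refine HasCompactSupport.of_support_subset_isCompact (hK₁.union (hvc n).isCompact)
            fun x hx ↦ ?_
          by_contra hx'
          simp only [mem_union, not_or] at hx'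
          apply hx
          have hd : mvfderiv I (χ - v n) x = 0 := by
            rw [mvfderiv_sub ((hχ x).mdifferentiableAt (by simp)) ((hv n x).mdifferentiableAt (by simp)),
              hχK x hx'.1, mvfderiv_eq_zero_of_notMem_tsupport hx'.2, sub_zero]
          simp [PseudoRiemannianMetric.gradSq, PseudoRiemannianMetric.innerDual, hd]
        · exact hgc.integrable_of_hasCompactSupport (HasCompactSupport.of_support_subset_isCompact
            (hK₁.union (hvc n).isCompact) fun x hx ↦ by
              by_contra hx'
              simp only [mem_union, not_or] at hx'
              apply hx
              have hd : mvfderiv I (χ - v n) x = 0 := by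
                rw [mvfderiv_sub ((hχ x).mdifferentiableAt (by simp))
                  ((hv n x).mdifferentiableAt (by simp)), hχK x hx'.1,
                  mvfderiv_eq_zero_of_notMem_tsupport hx'.2, sub_zero]
              simp [PseudoRiemannianMetric.gradSq, PseudoRiemannianMetric.innerDual, hd])
      refine integral_mono_of_nonneg (Eventually.of_forall fun x ↦ Real.rpow_nonneg (Real.sqrt_nonneg _) _)
        hIw (Eventually.of_forall fun x ↦ ?_)
      rw [ha]; dsimp only
      rw [Real.rpow_two, Real.sq_sqrt (mul_nonneg (hφ0 x) (hgn0 x))]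
      exact (mul_le_of_le_one_left (hgn0 x) (hφ1 x))
    have hb2 : ∫ x, b x ^ (2 : ℝ) ∂ν = T := by
      rw [hTdef]
      refine integral_congr_ae (Eventually.of_forall fun x ↦ ?_)
      rw [hb]; dsimp only
      rw [Real.rpow_two, Real.sq_sqrt (mul_nonneg (hφ0 x) (hG0 x))]
    have hIab : Integrable (fun x ↦ a x * b x) ν :=
      (hac.mul hbc).integrable_of_hasCompactSupport has.mul_right
    calc |Tn n| ≤ ∫ x, |φ x * (ofRiemannian h).innerDual x (mvfderiv I (χ - v n) x).toLinearMap
          (mvfderiv I ũ x).toLinearMap| ∂ν := abs_integral_le_integral_abs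
      _ ≤ ∫ x, a x * b x ∂ν := by
          refine integral_mono_of_nonneg (Eventually.of_forall fun x ↦ abs_nonneg _) hIab
            (Eventually.of_forall hpt)
      _ ≤ (∫ x, a x ^ (2 : ℝ) ∂ν) ^ (1 / (2 : ℝ)) * (∫ x, b x ^ (2 : ℝ) ∂ν) ^ (1 / (2 : ℝ)) := hCS
      _ ≤ Real.sqrt (∫ x, (ofRiemannian h).gradSq (χ - v n) x ∂ν) * Real.sqrt T := by
          rw [hb2, Real.sqrt_eq_rpow, Real.sqrt_eq_rpow]
          refine mul_le_mul_of_nonneg_right (Real.rpow_le_rpow ?_ ha2 (by norm_num))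
            (Real.rpow_nonneg hT0 _)
          exact integral_nonneg fun x ↦ Real.rpow_nonneg (Real.sqrt_nonneg _) _
  -- pass to the limit: `T ≤ √m' √T`
  have hm0 : 0 ≤ m' :=
    ge_of_tendsto' hE fun n ↦ integral_nonneg fun x ↦ innerDual_self_nonneg (h := h) x _
  have hle : T ≤ Real.sqrt m' * Real.sqrt T := by
    have h1 : Tendsto (fun n ↦ Real.sqrt (∫ x, (ofRiemannian h).gradSq (χ - v n) x ∂ν) * Real.sqrt T) atTop
        (𝓝 (Real.sqrt m' * Real.sqrt T)) :=
      ((Real.continuous_sqrt.tendsto m').comp hE).mul tendsto_const_nhds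
    have h2 : Tendsto (fun n ↦ |Tn n|) atTop (𝓝 |T|) := (continuous_abs.tendsto T).comp hlim
    have h3 := le_of_tendsto_of_tendsto' h2 h1 hbound
    rwa [abs_of_nonneg hT0] at h3
  -- conclude `T ≤ m'`
  by_cases hT : T = 0
  · rw [hT]; exact hm0
  · have hTpos : 0 < T := lt_of_le_of_ne hT0 (Ne.symm hT)
    have hsT : 0 < Real.sqrt T := Real.sqrt_pos.2 hTpos
    have h1 : Real.sqrt T * Real.sqrt T ≤ Real.sqrt m' * Real.sqrt T := by
      rw [Real.mul_self_sqrt hT0]; exact hle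
    have h2 : Real.sqrt T ≤ Real.sqrt m' := le_of_mul_le_mul_right h1 hsT
    calc T = Real.sqrt T ^ 2 := (Real.sq_sqrt hT0).symm
      _ ≤ Real.sqrt m' ^ 2 := pow_le_pow_left₀ (Real.sqrt_nonneg _) h2 2
      _ = m' := Real.sq_sqrt hm0


end Energy

/-! ### §2 Exhausting the ball by cutoffs, and the energy of the replacement -/

section Ball

variable {d : ℕ} {M : Type*} [TopologicalSpace M] [ChartedSpace (EuclideanSpace ℝ (Fin d)) M]
  [IsManifold 𝓘(ℝ, EuclideanSpace ℝ (Fin d)) ∞ M] [T2Space M]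
  (g : PseudoRiemannianMetric 𝓘(ℝ, EuclideanSpace ℝ (Fin d)) ∞ (EuclideanSpace ℝ (Fin d))
    (TangentSpace 𝓘(ℝ, EuclideanSpace ℝ (Fin d)) : M → Type _)) [g.HasLeviCivita]
  [CovariantDerivative.ContMDiffCovariantDerivative g.leviCivita 1]
  [CovariantDerivative.ContMDiffCovariantDerivative g.leviCivita ∞]

omit [CovariantDerivative.ContMDiffCovariantDerivative g.leviCivita ∞] in
/-- **From cutoff bounds to the energy bound on the ball**: if `G ≥ 0` is continuous on the open
ball `B = {d(p,·) < r}` of a connected complete Riemannian manifold and `∫ φ G ≤ m'` for every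
`φ ∈ C_c^∞(M; [0,1])` with `tsupport φ ⊆ B`, then `∫⁻_B ofReal G ≤ ofReal m'` (exhaust `B` by the
compact sets `K_k = {d(p,·) ≤ r − r/(k+2)}`, smooth Urysohn functions between `K_k` and
`{d(p,·) ≥ r - r/(2(k+2))}`... precisely supported in `K_{k+1}`-type closed balls inside `B`,
monotone convergence). [folklore] -/
theorem lintegral_ball_ofReal_le_of_forall_cutoff [ConnectedSpace M] [T3Space M]
    [SecondCountableTopology M] [MeasurableSpace M] [BorelSpace M] (hg : g.IsRiemannian)
    (hc : IsGeodesicallyComplete g.leviCivita) (p : M) {r : ℝ} (hr : 0 < r) {G : M → ℝ}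
    (hGc : ContinuousOn G {x : M | g.edist hg p x < ENNReal.ofReal r})
    (hG0 : ∀ x, g.edist hg p x < ENNReal.ofReal r → 0 ≤ G x) {m' : ℝ}
    (hcut : ∀ φ : M → ℝ, ContMDiff 𝓘(ℝ, EuclideanSpace ℝ (Fin d)) 𝓘(ℝ, ℝ) ∞ φ → HasCompactSupport φ →
      tsupport φ ⊆ {x : M | g.edist hg p x < ENNReal.ofReal r} → (∀ x, 0 ≤ φ x) → (∀ x, φ x ≤ 1) →
      ∫ x, φ x * G x ∂(riemannianMeasure (I := 𝓘(ℝ, (EuclideanSpace ℝ (Fin d))))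
        (g.toContMDiffRiemannianMetric hg)) ≤ m') :
    ∫⁻ x in {x : M | g.edist hg p x < ENNReal.ofReal r}, ENNReal.ofReal (G x)
        ∂(riemannianMeasure (I := 𝓘(ℝ, (EuclideanSpace ℝ (Fin d)))) (g.toContMDiffRiemannianMetric hg)) ≤
      ENNReal.ofReal m' := by
  haveI : LocallyCompactSpace M :=
    Manifold.locallyCompact_of_finiteDimensional 𝓘(ℝ, (EuclideanSpace ℝ (Fin d)))
  haveI : SigmaCompactSpace M := inferInstance
  set μ := riemannianMeasure (I := 𝓘(ℝ, (EuclideanSpace ℝ (Fin d)))) (g.toContMDiffRiemannianMetric hg)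
    with hμ
  haveI : IsFiniteMeasureOnCompacts μ :=
    ⟨fun K hK ↦ riemannianVolume_lt_top_of_isCompact_holds (g.toContMDiffRiemannianMetric hg) le_rfl hK⟩
  set B : Set M := {x : M | g.edist hg p x < ENNReal.ofReal r} with hB
  have hρc : Continuous fun x ↦ g.edist hg p x :=
    (PseudoRiemannianMetric.continuous_edist hg).comp (Continuous.prodMk_right p)
  have hBo : IsOpen B := isOpen_lt hρc continuous_const
  have hBm : MeasurableSet B := hBo.measurableSet
  -- the exhaustion `K k = {d ≤ r (1 - 1/(k+2))}` by compact sets, and the closed sets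
  -- `L k = {d ≥ r (1 - 1/(2(k+2)))}` with `K k ⊆ (L k)ᶜ ⊆ ... ⊆ B`
  set ρ : ℕ → ℝ := fun k ↦ r * (1 - 1 / ((k : ℝ) + 2)) with hρ
  set σ : ℕ → ℝ := fun k ↦ r * (1 - 1 / (2 * ((k : ℝ) + 2))) with hσ
  have hρpos : ∀ k, 0 ≤ ρ k := fun k ↦ by
    have : (1 : ℝ) / ((k : ℝ) + 2) ≤ 1 := by
      rw [div_le_one (by positivity)]; linarith [(Nat.cast_nonneg k : (0 : ℝ) ≤ k)]
    exact mul_nonneg hr.le (by linarith)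
  have hρσ : ∀ k, ρ k < σ k := fun k ↦ by
    have hk : (0 : ℝ) < (k : ℝ) + 2 := by positivity
    have : 1 / (2 * ((k : ℝ) + 2)) < 1 / ((k : ℝ) + 2) := by
      apply one_div_lt_one_div_of_lt hk; linarith
    exact mul_lt_mul_of_pos_left (by linarith) hr
  have hσr : ∀ k, σ k < r := fun k ↦ by
    have : 0 < 1 / (2 * ((k : ℝ) + 2)) := by positivity
    nlinarith
  set K : ℕ → Set M := fun k ↦ {x : M | g.edist hg p x ≤ ENNReal.ofReal (ρ k)} with hK
  set L : ℕ → Set M := fun k ↦ {x : M | ENNReal.ofReal (σ k) ≤ g.edist hg p x} with hL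
  have hKc : ∀ k, IsCompact (K k) := fun k ↦ by
    have h1 := isCompact_setOf_edist_le g le_rfl hg hc p ⟨ρ k, hρpos k⟩
    convert h1 using 1
    ext x
    simp only [hK, mem_setOf_eq, ENNReal.ofReal_eq_coe_nnreal (hρpos k)]
    rfl
  have hLcl : ∀ k, IsClosed (L k) := fun k ↦ isClosed_le continuous_const hρc
  have hKL : ∀ k, Disjoint (L k) (K k) := fun k ↦ by
    rw [Set.disjoint_left]
    intro x hxL hxK
    have h1 : ENNReal.ofReal (σ k) ≤ ENNReal.ofReal (ρ k) := hxL.trans hxK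
    exact absurd ((ENNReal.ofReal_le_ofReal_iff (hρpos k)).1 h1) (not_le.2 (hρσ k))
  have hLB : ∀ k, (L k)ᶜ ⊆ B := fun k x hx ↦ by
    simp only [hL, mem_compl_iff, mem_setOf_eq, not_le] at hx
    exact hx.trans (ENNReal.ofReal_lt_ofReal_iff_of_nonneg (by nlinarith [hρpos k, hρσ k]) |>.2 (hσr k))
  have hLcB : ∀ k, closure (L k)ᶜ ⊆ {x : M | g.edist hg p x ≤ ENNReal.ofReal (σ k)} := fun k ↦ by
    refine closure_minimal (fun x hx ↦ ?_) (isClosed_le hρc continuous_const)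
    simp only [hL, mem_compl_iff, mem_setOf_eq, not_le] at hx
    exact hx.le
  -- the truncated integrals are bounded by `m'`
  have hk : ∀ k : ℕ, ∫⁻ x, (K k).indicator (fun x ↦ ENNReal.ofReal (G x)) x ∂μ ≤ ENNReal.ofReal m' := by
    intro k
    obtain ⟨f, hf0, hf1, hf01⟩ := exists_contMDiffMap_zero_one_of_isClosed
      (I := 𝓘(ℝ, EuclideanSpace ℝ (Fin d))) (n := (⊤ : ℕ∞)) (hLcl k) (hKc k).isClosed (hKL k)
    have hfs : ContMDiff 𝓘(ℝ, EuclideanSpace ℝ (Fin d)) 𝓘(ℝ, ℝ) ∞ f := f.contMDiff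
    have hsuppf : tsupport (f : M → ℝ) ⊆ {x : M | g.edist hg p x ≤ ENNReal.ofReal (σ k)} := by
      refine (closure_mono fun x hx ↦ ?_).trans (hLcB k)
      exact fun hxL ↦ hx (hf0 hxL)
    have hfB : tsupport (f : M → ℝ) ⊆ B := fun x hx ↦ by
      have h1 := hsuppf hx
      simp only [mem_setOf_eq] at h1
      exact h1.trans_lt ((ENNReal.ofReal_lt_ofReal_iff_of_nonneg (by nlinarith [hρpos k, hρσ k])).2 (hσr k))
    have hfc : HasCompactSupport (f : M → ℝ) := by
      refine HasCompactSupport.of_support_subset_isCompact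
        (isCompact_setOf_edist_le g le_rfl hg hc p ⟨σ k, by nlinarith [hρpos k, hρσ k]⟩) fun x hx ↦ ?_
      have h1 := hsuppf (subset_tsupport _ hx)
      simp only [mem_setOf_eq] at h1 ⊢
      rwa [ENNReal.ofReal_eq_coe_nnreal] at h1
    have hbd := hcut f hfs hfc hfB (fun x ↦ (hf01 x).1) (fun x ↦ (hf01 x).2)
    -- `f G` is continuous (supported inside `B` where `G` is continuous) with compact support
    have hfGc : Continuous fun x ↦ f x * G x := by
      refine continuous_iff_continuousAt.2 fun x ↦ ?_
      by_cases hx : x ∈ B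
      · exact (f.contMDiff.continuous.continuousAt).mul (hGc.continuousAt (hBo.mem_nhds hx))
      · have hx' : x ∉ tsupport (f : M → ℝ) := fun h' ↦ hx (hfB h')
        have hev : (fun x ↦ f x * G x) =ᶠ[𝓝 x] fun _ ↦ 0 := by
          filter_upwards [(isClosed_tsupport _).isOpen_compl.mem_nhds hx'] with z hz
          rw [image_eq_zero_of_notMem_tsupport hz, zero_mul]
        exact continuousAt_const.congr_of_eventuallyEq hev
    have hI : Integrable (fun x ↦ f x * G x) μ := hfGc.integrable_of_hasCompactSupport hfc.mul_right
    calc ∫⁻ x, (K k).indicator (fun x ↦ ENNReal.ofReal (G x)) x ∂μ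
        ≤ ∫⁻ x, ENNReal.ofReal (f x * G x) ∂μ := by
          refine lintegral_mono fun x ↦ ?_
          by_cases hx : x ∈ K k
          · rw [indicator_of_mem hx, hf1 hx]; simp
          · rw [indicator_of_notMem hx]; exact bot_le
      _ = ENNReal.ofReal (∫ x, f x * G x ∂μ) := by
          rw [ofReal_integral_eq_lintegral_ofReal hI]
          refine Eventually.of_forall fun x ↦ ?_
          by_cases hx : x ∈ B
          · exact mul_nonneg (hf01 x).1 (hG0 x hx)
          · have hx' : x ∉ tsupport (f : M → ℝ) := fun h' ↦ hx (hfB h')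
            simp [image_eq_zero_of_notMem_tsupport hx']
      _ ≤ ENNReal.ofReal m' := ENNReal.ofReal_le_ofReal hbd
  -- monotone convergence along the exhaustion
  have hmono : Monotone fun k ↦ (K k).indicator (fun x ↦ ENNReal.ofReal (G x)) := by
    intro i j hij x
    refine indicator_le_indicator_of_subset (fun y hy ↦ ?_) (fun _ ↦ bot_le) x
    simp only [hK, mem_setOf_eq] at hy ⊢
    refine hy.trans (ENNReal.ofReal_le_ofReal ?_)
    simp only [hρ]
    have h1 : (1 : ℝ) / ((j : ℝ) + 2) ≤ 1 / ((i : ℝ) + 2) :=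
      one_div_le_one_div_of_le (by positivity) (by exact_mod_cast Nat.add_le_add_right hij 2)
    nlinarith
  have hKB : ∀ j, K j ⊆ B := fun j y hy ↦ by
    simp only [hK, mem_setOf_eq] at hy
    exact hy.trans_lt ((ENNReal.ofReal_lt_ofReal_iff_of_nonneg (hρpos j)).2 ((hρσ j).trans (hσr j)))
  have hsup : ∀ x ∈ B, (⨆ k, (K k).indicator (fun x ↦ ENNReal.ofReal (G x)) x) = ENNReal.ofReal (G x) := by
    intro x hx
    have hxr : (g.edist hg p x).toReal < r := (ENNReal.lt_ofReal_iff_toReal_lt (edist_ne_top hg p x)).1 hx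
    obtain ⟨k, hk⟩ : ∃ k : ℕ, (g.edist hg p x).toReal ≤ ρ k := by
      obtain ⟨k, hk⟩ := exists_nat_gt (r / (r - (g.edist hg p x).toReal))
      refine ⟨k, ?_⟩
      simp only [hρ]
      have hpos : 0 < r - (g.edist hg p x).toReal := by linarith
      have h1 : r / (r - (g.edist hg p x).toReal) < (k : ℝ) + 2 := by linarith
      rw [div_lt_iff₀ hpos] at h1
      have h2 : r * (1 - 1 / ((k : ℝ) + 2)) = r - r / ((k : ℝ) + 2) := by ring
      rw [h2]
      have h3 : r / ((k : ℝ) + 2) < r - (g.edist hg p x).toReal := by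
        rw [div_lt_iff₀ (by positivity)]; linarith
      linarith
    have hxK : x ∈ K k := by
      simp only [hK, mem_setOf_eq]
      rw [← ENNReal.ofReal_toReal (edist_ne_top hg p x)]
      exact ENNReal.ofReal_le_ofReal hk
    refine le_antisymm (iSup_le fun j ↦ ?_) ?_
    · by_cases hxj : x ∈ K j
      · rw [indicator_of_mem hxj]
      · rw [indicator_of_notMem hxj]; exact bot_le
    · refine le_iSup_of_le k ?_
      rw [indicator_of_mem hxK]
  -- measurability on `B`
  have hGae : AEMeasurable (fun x ↦ ENNReal.ofReal (G x)) (μ.restrict B) :=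
    ENNReal.measurable_ofReal.comp_aemeasurable (hGc.aemeasurable hBm)
  have hKm : ∀ k, MeasurableSet (K k) := fun k ↦ (hKc k).isClosed.measurableSet
  calc ∫⁻ x in B, ENNReal.ofReal (G x) ∂μ
      = ∫⁻ x in B, ⨆ k, (K k).indicator (fun x ↦ ENNReal.ofReal (G x)) x ∂μ := by
        refine setLIntegral_congr_fun hBm fun x hx ↦ ?_
        rw [hsup x hx]
    _ = ⨆ k, ∫⁻ x in B, (K k).indicator (fun x ↦ ENNReal.ofReal (G x)) x ∂μ := by
        refine lintegral_iSup' (fun k ↦ hGae.indicator (hKm k)) (ae_of_all _ fun x i j hij ↦ hmono hij x)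
    _ ≤ ⨆ k, ∫⁻ x, (K k).indicator (fun x ↦ ENNReal.ofReal (G x)) x ∂μ :=
        iSup_mono fun k ↦ setLIntegral_le_lintegral _ _
    _ ≤ ENNReal.ofReal m' := iSup_le hk

omit [CovariantDerivative.ContMDiffCovariantDerivative g.leviCivita ∞] in
/-- **The harmonic replacement does not increase the Dirichlet energy** (Dirichlet's principle;
Cheeger–Colding 1996, §6): for the data `v, w, vₙ, m_E` of `exists_harmonic_replacement_ball`
(`v` smooth harmonic on `B = B_r(p)`, `χ - w = v` a.e. on `B`, `vₙ → w` in `L²`, energies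
`E(vₙ) → m_E = inf E`), `∫⁻_B ofReal |dv|²_g ≤ ofReal m_E`, and `m_E ≤ ∫ |dχ|²_g`.
[cite: CheegerColding1996, §6] [cite: GilbargTrudinger2001, §8.2] -/
theorem lintegral_ball_gradSq_replacement_le [ConnectedSpace M] [T3Space M]
    [SecondCountableTopology M] [MeasurableSpace M] [BorelSpace M] (hg : g.IsRiemannian)
    (hc : IsGeodesicallyComplete g.leviCivita)
    {χ : M → ℝ} (hχ : ContMDiff 𝓘(ℝ, (EuclideanSpace ℝ (Fin d))) 𝓘(ℝ, ℝ) ∞ χ)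
    {K₁ : Set M} (hK₁ : IsCompact K₁)
    (hχK : ∀ x ∉ K₁, mvfderiv 𝓘(ℝ, (EuclideanSpace ℝ (Fin d))) χ x = 0)
    (p : M) {r : ℝ} (hr : 0 < r) {v w : M → ℝ} {vn : ℕ → M → ℝ} {mE : ℝ}
    (hv : ContMDiffOn 𝓘(ℝ, (EuclideanSpace ℝ (Fin d))) 𝓘(ℝ, ℝ) ∞ v
      {x : M | g.edist hg p x < ENNReal.ofReal r})
    (hΔ : ∀ x, g.edist hg p x < ENNReal.ofReal r → g.laplaceBeltrami v x = 0)
    (hwmem : MemLp w 2 (riemannianMeasure (I := 𝓘(ℝ, (EuclideanSpace ℝ (Fin d))))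
      (g.toContMDiffRiemannianMetric hg)))
    (hwv : ∀ᵐ x ∂(riemannianMeasure (I := 𝓘(ℝ, (EuclideanSpace ℝ (Fin d))))
      (g.toContMDiffRiemannianMetric hg)), g.edist hg p x < ENNReal.ofReal r → χ x - w x = v x)
    (hvs : ∀ n, ContMDiff 𝓘(ℝ, (EuclideanSpace ℝ (Fin d))) 𝓘(ℝ, ℝ) ∞ (vn n))
    (hvc : ∀ n, HasCompactSupport (vn n))
    (hlim : Tendsto (fun n ↦ eLpNorm (vn n - w) 2 (riemannianMeasure (I := 𝓘(ℝ, (EuclideanSpace ℝ (Fin d))))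
      (g.toContMDiffRiemannianMetric hg))) atTop (𝓝 0))
    (hmle : ∀ u : M → ℝ, ContMDiff 𝓘(ℝ, (EuclideanSpace ℝ (Fin d))) 𝓘(ℝ, ℝ) ∞ u → HasCompactSupport u →
      (∀ x, ENNReal.ofReal r ≤ g.edist hg p x → u x = 0) →
      mE ≤ ∫ x, g.gradSq (χ - u) x ∂(riemannianMeasure (I := 𝓘(ℝ, (EuclideanSpace ℝ (Fin d))))
        (g.toContMDiffRiemannianMetric hg)))
    (hEv : Tendsto (fun n ↦ ∫ x, g.gradSq (χ - vn n) x
      ∂(riemannianMeasure (I := 𝓘(ℝ, (EuclideanSpace ℝ (Fin d)))) (g.toContMDiffRiemannianMetric hg)))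
      atTop (𝓝 mE)) :
    ∫⁻ x in {x : M | g.edist hg p x < ENNReal.ofReal r}, ENNReal.ofReal (g.gradSq v x)
        ∂(riemannianMeasure (I := 𝓘(ℝ, (EuclideanSpace ℝ (Fin d)))) (g.toContMDiffRiemannianMetric hg)) ≤
      ENNReal.ofReal mE ∧
    mE ≤ ∫ x, g.gradSq χ x
      ∂(riemannianMeasure (I := 𝓘(ℝ, (EuclideanSpace ℝ (Fin d)))) (g.toContMDiffRiemannianMetric hg)) := by
  haveI : LocallyCompactSpace M :=
    Manifold.locallyCompact_of_finiteDimensional 𝓘(ℝ, (EuclideanSpace ℝ (Fin d)))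
  haveI : SigmaCompactSpace M := inferInstance
  haveI : Fact ((1 : ℕ∞ω) ≤ (∞ : ℕ∞ω)) := ⟨by exact_mod_cast le_top⟩
  set h := g.toContMDiffRiemannianMetric hg with hh
  set μ := riemannianMeasure (I := 𝓘(ℝ, (EuclideanSpace ℝ (Fin d)))) h with hμ
  haveI : IsFiniteMeasureOnCompacts μ :=
    ⟨fun K hK ↦ riemannianVolume_lt_top_of_isCompact_holds h le_rfl hK⟩
  have hOf : ofRiemannian h = g := by ext; rfl
  haveI iLC : (ofRiemannian h).HasLeviCivita := by rw [hOf]; infer_instance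
  set B : Set M := {x : M | g.edist hg p x < ENNReal.ofReal r} with hB
  have hρc : Continuous fun x ↦ g.edist hg p x :=
    (PseudoRiemannianMetric.continuous_edist hg).comp (Continuous.prodMk_right p)
  have hBo : IsOpen B := isOpen_lt hρc continuous_const
  refine ⟨?_, ?_⟩
  swap
  · -- `m_E ≤ E(0) = ∫ |dχ|²`
    have h0 := hmle 0 contMDiff_const HasCompactSupport.zero (fun _ _ ↦ rfl)
    simpa using h0
  -- continuity of `|dv|²` on `B`
  have hvat : ∀ x ∈ B, ContMDiffAt 𝓘(ℝ, (EuclideanSpace ℝ (Fin d))) 𝓘(ℝ, ℝ) ∞ v x := fun x hx ↦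
    hv.contMDiffAt (hBo.mem_nhds hx)
  have hGc : ContinuousOn (g.gradSq v) B := by
    intro x hx
    obtain ⟨V, O, hVs, -, hOo, hxO, hOB, hVO⟩ :=
      exists_contMDiff_hasCompactSupport_eqOn_nhds (m := d) hBo hv isCompact_singleton
        (singleton_subset_iff.2 hx)
    have hxO' : x ∈ O := hxO rfl
    have hev : ∀ z ∈ O, g.gradSq v z = g.gradSq V z := by
      intro z hz
      have h1 : v =ᶠ[𝓝 z] V := by
        filter_upwards [hOo.mem_nhds hz] with y hy using (hVO hy).symm
      simp only [PseudoRiemannianMetric.gradSq, mvfderiv_congr_of_eventuallyEq h1]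
    have hcV : Continuous (g.gradSq V) := (contMDiff_gradSq g hVs).continuous
    refine (hcV.continuousAt.congr_of_eventuallyEq ?_).continuousWithinAt
    filter_upwards [hOo.mem_nhds hxO'] with z hz using hev z hz
  refine lintegral_ball_ofReal_le_of_forall_cutoff g hg hc p hr hGc (fun x _ ↦ g.gradSq_nonneg hg v x)
    fun φ hφ hφc hφB hφ0 hφ1 ↦ ?_
  -- the cutoff bound: globalise `v` near `tsupport φ` and apply the local Carron lemma
  obtain ⟨V, O, hVs, hVc, hOo, hKO, hOB, hVO⟩ :=
    exists_contMDiff_hasCompactSupport_eqOn_nhds (m := d) hBo hv hφc.isCompact hφB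
  have hgradV : ∀ x ∈ tsupport φ, g.gradSq v x = g.gradSq V x := by
    intro x hx
    have h1 : v =ᶠ[𝓝 x] V := by
      filter_upwards [hOo.mem_nhds (hKO hx)] with y hy using (hVO hy).symm
    simp only [PseudoRiemannianMetric.gradSq, mvfderiv_congr_of_eventuallyEq h1]
  have hΔV : ∀ x ∈ tsupport φ, (ofRiemannian h).dalembertian V x = 0 := by
    intro x hx
    have h1 : V =ᶠ[𝓝 x] v := by
      filter_upwards [hOo.mem_nhds (hKO hx)] with y hy using hVO hy
    rw [(ofRiemannian h).dalembertian_congr_of_eventuallyEq h1, dalembertian_congr_metric hOf,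
      ← laplaceBeltrami_eq_dalembertian]
    exact hΔ x (hOB (hKO hx))
  -- the convergence hypothesis on test fields supported in `tsupport φ`
  have hconv : ∀ F : M → ℝ, Continuous F → HasCompactSupport F → support F ⊆ tsupport φ →
      Tendsto (fun n ↦ ∫ x, ((χ x - vn n x) - V x) * F x ∂riemannianMeasure h) atTop (𝓝 0) := by
    intro F hFc hFs hFsupp
    obtain ⟨C, hC⟩ := hFs.exists_bound_of_continuous hFc
    have hFC : ∀ x, |F x| ≤ max C 0 := fun x ↦ (Real.norm_eq_abs (F x) ▸ hC x).trans (le_max_left _ _)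
    have hvq : ∀ n, MemLp (vn n) 2 μ := fun n ↦ (hvs n).continuous.memLp_of_hasCompactSupport (hvc n)
    have hF0 : ∀ x ∉ tsupport φ, F x = 0 := fun x hx ↦ by
      by_contra h'; exact hx (hFsupp (mem_support.2 h'))
    obtain ⟨-, hT⟩ := tendsto_integral_sub_mul_of_tendsto_eLpNorm (ν := μ) (by norm_num) hvq hwmem hlim
      (isClosed_tsupport φ).measurableSet hφc.isCompact.measure_lt_top (le_max_right C 0) hFC hF0
      hFc.aestronglyMeasurable
    -- `((χ - vₙ) - V) F = -( (vₙ - w) F ) + ((χ - w) - V) F`, the last term is a.e. zero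
    have hae0 : (fun x ↦ ((χ x - w x) - V x) * F x) =ᵐ[μ] fun _ ↦ 0 := by
      filter_upwards [hwv] with x hx
      by_cases hxφ : x ∈ tsupport φ
      · rw [hx (hOB (hKO hxφ)), ← hVO (hKO hxφ), sub_self, zero_mul]
      · rw [hF0 x hxφ, mul_zero]
    have heq : ∀ n, ∫ x, ((χ x - vn n x) - V x) * F x ∂μ = -∫ x, (vn n x - w x) * F x ∂μ := by
      intro n
      rw [← integral_neg]
      refine integral_congr_ae ?_
      filter_upwards [hae0] with x hx
      have : ((χ x - w x) - V x) * F x = 0 := hx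
      linear_combination this
    rw [show (0 : ℝ) = -0 by simp]
    exact (hT.neg).congr fun n ↦ (heq n).symm
  have key := integral_mul_gradSq_le_of_tendsto_of_tsupport (I := 𝓘(ℝ, (EuclideanSpace ℝ (Fin d)))) h hχ
    hVs hvs hvc hK₁ hχK (m' := mE) (by rw [hOf]; exact hEv) hφ hφc hφ0 hφ1 hΔV hconv
  rw [hOf] at key
  calc ∫ x, φ x * g.gradSq v x ∂μ = ∫ x, φ x * g.gradSq V x ∂μ := by
        refine integral_congr_ae (Eventually.of_forall fun x ↦ ?_)
        by_cases hx : x ∈ tsupport φ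
        · simp only [hgradV x hx]
        · simp only [image_eq_zero_of_notMem_tsupport hx, zero_mul]
    _ ≤ mE := key

end Ball

end Literature.Geometry.Riemannian

end
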